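import Summits.QuantumFields.YangMills.Theorems.BalabanLadderUVSeamRecResponseMomentsPinning
import HarnessLib

/-!
# Crux `UVSeamRec` (stmt-QuantumFields-20043), v5(α) stub `stub_responseMomentsOdd6` (RM): the two RECENTRING conversions
# — (RM) about `L`-independent reference values versus response moments centred at the torus means

Helper file (`--supports stmt-QuantumFields-20043`) of the stub-helper seat `ym-20043-seam-s2` (lane S-A, gen 2); sequel of
`…ResponseMomentsPinning.lean` (§1 there: (RM) pins `p q β` to the torus plaquette means within `C₁(e^B − 1)/R⁴`).

The registered binder (RM) (`ResponseMomentsDefs.ResponseMomentsOdd6SU2`; the `hRM` of p532025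
`TemperedResponse.momentBounds6_of_responseMoments`) measures the cube-kernel responses against reference values `p q β`
that do NOT depend on the torus side.  A probabilistic engine naturally produces response moments CENTRED AT THE TORUS
MEANS `⟨plane q x⟩_{2L+1,β}`; a renormalisation-group engine naturally produces a bulk value `p(β)`.  The two currencies
are interchangeable at explicit cost, kernel-checked here for general `(G, r, a)`:

* `exp_sum_abs_sub_le_of_close`, **`torusE_exp_sum_response_recentre`** — recentring of an exponential response sum at ONE
  coupling / torus / family: centres within `δ` cost a factor `exp((R⁴/C₁)δ·#T)` (the core both conversions and the
  strong-coupling rung use);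
* **`responseMomentsCentred_of_responseMoments`** — (RM)[`p`, `B`] ⇒ centred response moments with `B ↦ B + e^B − 1`;
* **`responseMoments_of_centred_of_pinned`** — centred response moments [`B`] + the finite-size pinning
  `|⟨plane q x⟩_{2L+1,β} − p q β| ≤ D/R⁴` on the same guards ⇒ (RM)[`p`, `B ↦ B + D/C₁`] (the `hRM` of p532025 / the body of
  the registered stub verbatim).  Together with `…Pinning` §1–§2: (RM) ⟺ «centred response moments» ∧ «finite-size pinning
  of the plaquette means to an `L`-independent value at rate `R⁻⁴`» — an engine may deliver the two halves separately.

HONEST FRAMING: glue for ONE binder of a CONDITIONAL chain; (RM) at `β → ∞` is OPEN (E0′-K with background); nothing of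
it and nothing of E0′ is proved here; not a gap, not Clay.

References: as `…ResponseMomentsPinning` (Georgii (2011) Thm. 4.17 for the DLR part; `1 + y ≤ eʸ`).
-/

set_option autoImplicit false

noncomputable section

open MeasureTheory Filter Topology Finset
open Literature.MathematicalPhysics.QuantumFieldTheory (GaugeConfig wilsonMeasure isProbabilityMeasure_wilsonMeasure
  LatticeRep)
open Literature.MathematicalPhysics.QuantumLattice
open Literature.Probability.LatticeModels
open Summit.QuantumFields.YangMills.Cruxes.OSLegsFromFemtoAndGap.DlrCollarTransfer
open Summit.QuantumFields.YangMills.Cruxes.UVSeamRec.TemperedResponse (continuous_kerE_plane)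

namespace Summit.QuantumFields.YangMills.Cruxes.UVSeamRec.ResponsePinning

variable {G : Type} [Group G] [TopologicalSpace G] [IsTopologicalGroup G] [CompactSpace G]
  [MeasurableSpace G] [BorelSpace G] (r : LatticeRep G)

/-! ## Pointwise recentring and continuity of the exponential response sums -/

section Pointwise

/-- Pointwise recentring of an exponential response sum: if `|p i − m i| ≤ δ` for `i ∈ T` and `λ ≥ 0`, then
`exp(Σ_{i∈T} λ|k i − m i|) ≤ exp(λδ·#T) · exp(Σ_{i∈T} λ|k i − p i|)`. [folklore] -/
theorem exp_sum_abs_sub_le_of_close {n : ℕ} (T : Finset (Fin n)) (k p m : Fin n → ℝ) {lam δ : ℝ} (hlam : 0 ≤ lam)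
    (hclose : ∀ i ∈ T, |p i - m i| ≤ δ) :
    Real.exp (∑ i ∈ T, lam * |k i - m i|) ≤
      Real.exp (lam * δ * T.card) * Real.exp (∑ i ∈ T, lam * |k i - p i|) := by
  rw [← Real.exp_add]
  refine Real.exp_le_exp.2 ?_
  have hpt : ∀ i ∈ T, lam * |k i - m i| ≤ lam * δ + lam * |k i - p i| := fun i hi => by
    have : |k i - m i| ≤ |k i - p i| + |p i - m i| := by
      calc |k i - m i| = |(k i - p i) + (p i - m i)| := by ring_nf
        _ ≤ |k i - p i| + |p i - m i| := abs_add_le _ _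
    nlinarith [hclose i hi, abs_nonneg (k i - p i)]
  calc ∑ i ∈ T, lam * |k i - m i| ≤ ∑ i ∈ T, (lam * δ + lam * |k i - p i|) := Finset.sum_le_sum hpt
    _ = lam * δ * T.card + ∑ i ∈ T, lam * |k i - p i| := by
        rw [Finset.sum_add_distrib, Finset.sum_const, nsmul_eq_mul]; ring

/-- Continuity of an exponential response sum in the exterior. [folklore] -/
theorem continuous_exp_sum_response (β : ℝ) {n : ℕ} (T : Finset (Fin n)) (q : Fin n → Fin 4 × Fin 4)
    (x : Fin n → (Fin 4 → ℤ)) (R : ℕ) (lam : ℝ) (c : Fin n → ℝ) :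
    Continuous fun U : LGConfig 4 G => Real.exp (∑ i ∈ T, lam *
      |kerE G r β (fun k => x i k - (R + 1)) (2 * R + 3) U (plane G r (q i) (x i)) - c i|) :=
  Real.continuous_exp.comp (continuous_finsetSum T fun i _ =>
    continuous_const.mul ((continuous_kerE_plane r β _ _ (q i) (x i)).sub continuous_const).abs)

/-- **Recentring at one coupling, one torus, one family (the core estimate).**  For `C₁ > 0` and two sets of centres
`c, c'` with `|c i − c' i| ≤ δ` on `T`:
`⟨exp(Σ_{i∈T} (R⁴/C₁)|kerE_i − c' i|)⟩_{2L+1,β} ≤ exp((R⁴/C₁)·δ·#T) · ⟨exp(Σ_{i∈T} (R⁴/C₁)|kerE_i − c i|)⟩_{2L+1,β}`.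
[folklore] -/
theorem torusE_exp_sum_response_recentre (β : ℝ) (L : ℕ) {n : ℕ} (T : Finset (Fin n)) (q : Fin n → Fin 4 × Fin 4)
    (x : Fin n → (Fin 4 → ℤ)) (R : ℕ) {C₁ : ℝ} (hC₁ : 0 < C₁) (c c' : Fin n → ℝ) {δ : ℝ}
    (hclose : ∀ i ∈ T, |c i - c' i| ≤ δ) :
    torusE G r β L (fun U => Real.exp (∑ i ∈ T, (R : ℝ) ^ 4 / C₁ *
        |kerE G r β (fun k => x i k - (R + 1)) (2 * R + 3) U (plane G r (q i) (x i)) - c' i|)) ≤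
      Real.exp ((R : ℝ) ^ 4 / C₁ * δ * T.card) *
        torusE G r β L (fun U => Real.exp (∑ i ∈ T, (R : ℝ) ^ 4 / C₁ *
          |kerE G r β (fun k => x i k - (R + 1)) (2 * R + 3) U (plane G r (q i) (x i)) - c i|)) := by
  have hlam : 0 ≤ (R : ℝ) ^ 4 / C₁ := by positivity
  have hpt := fun U : LGConfig 4 G => exp_sum_abs_sub_le_of_close T
    (fun i => kerE G r β (fun k => x i k - (R + 1)) (2 * R + 3) U (plane G r (q i) (x i))) c c' hlam hclose
  calc torusE G r β L (fun U => Real.exp (∑ i ∈ T, (R : ℝ) ^ 4 / C₁ *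
          |kerE G r β (fun k => x i k - (R + 1)) (2 * R + 3) U (plane G r (q i) (x i)) - c' i|))
      ≤ torusE G r β L (fun U => Real.exp ((R : ℝ) ^ 4 / C₁ * δ * T.card) *
          Real.exp (∑ i ∈ T, (R : ℝ) ^ 4 / C₁ *
            |kerE G r β (fun k => x i k - (R + 1)) (2 * R + 3) U (plane G r (q i) (x i)) - c i|)) :=
        torusE_mono r β L (continuous_exp_sum_response r β T q x R _ _)
          (continuous_const.mul (continuous_exp_sum_response r β T q x R _ _)) hpt
    _ = _ := torusE_const_mul' r β L _ _

end Pointwise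

/-! ## The two conversions -/

section Recentring

variable (a : ℝ → ℝ)

/-- **Conversion 1: (RM) about `L`-independent reference values ⇒ (RM) centred at the torus means.**  Under (RM) at unit
`a` [`p`, `C₁ > 0`, `B`, `β₁`, `ℓ₁`] (the `hRM` of p532025 VERBATIM), on the same guards and for every index set `T`,
`⟨exp(Σ_{i∈T} (R⁴/C₁)|kerE_{cube i}(plane_i) − ⟨plane_i⟩_{2L+1,β}|)⟩_{2L+1,β} ≤ exp((B + e^B − 1)·#T)` — the means are
within `C₁(e^B − 1)/R⁴` of the `p`'s (`…Pinning` §1), which costs `e^B − 1` per member in the exponent. [folklore] -/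
theorem responseMomentsCentred_of_responseMoments {C₁ B β₁ ℓ₁ : ℝ} {p : Fin 4 × Fin 4 → ℝ → ℝ} (hC₁ : 0 < C₁)
    (hRM : ∀ β : ℝ, β₁ ≤ β → ∀ (L n : ℕ) (q : Fin n → Fin 4 × Fin 4) (x : Fin n → (Fin 4 → ℤ)) (R : ℕ),
      (∀ i, (q i).1 < (q i).2) → 1 ≤ R → (R : ℝ) * a β ≤ ℓ₁ → 4 * R + 8 ≤ L →
      (∀ i j : Fin n, i ≠ j → ∃ k : Fin 4,
        (2 * (R : ℤ) + 4) ≤ |((((x i k - x j k : ℤ) : ZMod (2 * L + 1))).valMinAbs : ℤ)|) →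
      ∀ T : Finset (Fin n),
        torusE G r β L (fun U => Real.exp (∑ i ∈ T, (R : ℝ) ^ 4 / C₁ *
          |kerE G r β (fun k => x i k - (R + 1)) (2 * R + 3) U (plane G r (q i) (x i)) - p (q i) β|)) ≤
          Real.exp (B * T.card)) :
    ∀ β : ℝ, β₁ ≤ β → ∀ (L n : ℕ) (q : Fin n → Fin 4 × Fin 4) (x : Fin n → (Fin 4 → ℤ)) (R : ℕ),
      (∀ i, (q i).1 < (q i).2) → 1 ≤ R → (R : ℝ) * a β ≤ ℓ₁ → 4 * R + 8 ≤ L →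
      (∀ i j : Fin n, i ≠ j → ∃ k : Fin 4,
        (2 * (R : ℤ) + 4) ≤ |((((x i k - x j k : ℤ) : ZMod (2 * L + 1))).valMinAbs : ℤ)|) →
      ∀ T : Finset (Fin n),
        torusE G r β L (fun U => Real.exp (∑ i ∈ T, (R : ℝ) ^ 4 / C₁ *
          |kerE G r β (fun k => x i k - (R + 1)) (2 * R + 3) U (plane G r (q i) (x i)) -
            torusE G r β L (plane G r (q i) (x i))|)) ≤
          Real.exp ((B + (Real.exp B - 1)) * T.card) := by
  intro β hβ L n q x R hq hR hRa hRL hsep T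
  have hR0 : (0 : ℝ) < R := by exact_mod_cast (show 0 < R by omega)
  -- the pinning of each mean (`…Pinning` §1)
  have hclose : ∀ i ∈ T, |p (q i) β - torusE G r β L (plane G r (q i) (x i))| ≤
      C₁ * (Real.exp B - 1) / (R : ℝ) ^ 4 := fun i _ => by
    rw [abs_sub_comm]
    exact abs_torusE_plane_sub_le_of_responseMoments r a hC₁ hRM hβ (q i) (x i) (hq i) hR hRa hRL
  have hδ : (R : ℝ) ^ 4 / C₁ * (C₁ * (Real.exp B - 1) / (R : ℝ) ^ 4) * T.card = (Real.exp B - 1) * T.card := by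
    field_simp
  calc _ ≤ Real.exp ((R : ℝ) ^ 4 / C₁ * (C₁ * (Real.exp B - 1) / (R : ℝ) ^ 4) * T.card) *
          torusE G r β L (fun U => Real.exp (∑ i ∈ T, (R : ℝ) ^ 4 / C₁ *
            |kerE G r β (fun k => x i k - (R + 1)) (2 * R + 3) U (plane G r (q i) (x i)) - p (q i) β|)) :=
        torusE_exp_sum_response_recentre r β L T q x R hC₁ (fun i => p (q i) β)
          (fun i => torusE G r β L (plane G r (q i) (x i))) hclose
    _ ≤ Real.exp ((Real.exp B - 1) * T.card) * Real.exp (B * T.card) := by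
        rw [hδ]
        exact mul_le_mul_of_nonneg_left (hRM β hβ L n q x R hq hR hRa hRL hsep T) (Real.exp_nonneg _)
    _ = Real.exp ((B + (Real.exp B - 1)) * T.card) := by rw [← Real.exp_add]; ring_nf

/-- **Conversion 2: centred response moments + finite-size pinning ⇒ (RM) about `L`-independent reference values.**
If on the guards (`β ≥ β₁`, `1 ≤ R`, `R·a β ≤ ℓ₁`, `4R+8 ≤ L`, cyclic separation) the response sums CENTRED AT THE TORUS
MEANS have joint exponential moments `≤ exp(B·#T)`, and the means are pinned to `L`-independent values,
`|⟨plane q x⟩_{2L+1,β} − p q β| ≤ D/R⁴` (same guards, `q.1 < q.2`), then (RM) holds about `p` with `B ↦ B + D/C₁` — the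
`hRM` of p532025 / the body of the registered stub.  An engine may thus deliver «typical response» and «finite-size
insensitivity of the plaquette mean» separately. [folklore] -/
theorem responseMoments_of_centred_of_pinned {C₁ B D β₁ ℓ₁ : ℝ} {p : Fin 4 × Fin 4 → ℝ → ℝ} (hC₁ : 0 < C₁)
    (hcen : ∀ β : ℝ, β₁ ≤ β → ∀ (L n : ℕ) (q : Fin n → Fin 4 × Fin 4) (x : Fin n → (Fin 4 → ℤ)) (R : ℕ),
      (∀ i, (q i).1 < (q i).2) → 1 ≤ R → (R : ℝ) * a β ≤ ℓ₁ → 4 * R + 8 ≤ L →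
      (∀ i j : Fin n, i ≠ j → ∃ k : Fin 4,
        (2 * (R : ℤ) + 4) ≤ |((((x i k - x j k : ℤ) : ZMod (2 * L + 1))).valMinAbs : ℤ)|) →
      ∀ T : Finset (Fin n),
        torusE G r β L (fun U => Real.exp (∑ i ∈ T, (R : ℝ) ^ 4 / C₁ *
          |kerE G r β (fun k => x i k - (R + 1)) (2 * R + 3) U (plane G r (q i) (x i)) -
            torusE G r β L (plane G r (q i) (x i))|)) ≤
          Real.exp (B * T.card))
    (hpin : ∀ β : ℝ, β₁ ≤ β → ∀ (L : ℕ) (q : Fin 4 × Fin 4) (x : Fin 4 → ℤ) (R : ℕ), q.1 < q.2 → 1 ≤ R →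
      (R : ℝ) * a β ≤ ℓ₁ → 4 * R + 8 ≤ L → |torusE G r β L (plane G r q x) - p q β| ≤ D / (R : ℝ) ^ 4) :
    ∀ β : ℝ, β₁ ≤ β → ∀ (L n : ℕ) (q : Fin n → Fin 4 × Fin 4) (x : Fin n → (Fin 4 → ℤ)) (R : ℕ),
      (∀ i, (q i).1 < (q i).2) → 1 ≤ R → (R : ℝ) * a β ≤ ℓ₁ → 4 * R + 8 ≤ L →
      (∀ i j : Fin n, i ≠ j → ∃ k : Fin 4,
        (2 * (R : ℤ) + 4) ≤ |((((x i k - x j k : ℤ) : ZMod (2 * L + 1))).valMinAbs : ℤ)|) →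
      ∀ T : Finset (Fin n),
        torusE G r β L (fun U => Real.exp (∑ i ∈ T, (R : ℝ) ^ 4 / C₁ *
          |kerE G r β (fun k => x i k - (R + 1)) (2 * R + 3) U (plane G r (q i) (x i)) - p (q i) β|)) ≤
          Real.exp ((B + D / C₁) * T.card) := by
  intro β hβ L n q x R hq hR hRa hRL hsep T
  have hR0 : (0 : ℝ) < R := by exact_mod_cast (show 0 < R by omega)
  have hclose : ∀ i ∈ T, |torusE G r β L (plane G r (q i) (x i)) - p (q i) β| ≤ D / (R : ℝ) ^ 4 :=
    fun i _ => hpin β hβ L (q i) (x i) R (hq i) hR hRa hRL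
  have hδ : (R : ℝ) ^ 4 / C₁ * (D / (R : ℝ) ^ 4) * T.card = D / C₁ * T.card := by
    field_simp
  calc _ ≤ Real.exp ((R : ℝ) ^ 4 / C₁ * (D / (R : ℝ) ^ 4) * T.card) *
          torusE G r β L (fun U => Real.exp (∑ i ∈ T, (R : ℝ) ^ 4 / C₁ *
            |kerE G r β (fun k => x i k - (R + 1)) (2 * R + 3) U (plane G r (q i) (x i)) -
              torusE G r β L (plane G r (q i) (x i))|)) :=
        torusE_exp_sum_response_recentre r β L T q x R hC₁ (fun i => torusE G r β L (plane G r (q i) (x i)))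
          (fun i => p (q i) β) hclose
    _ ≤ Real.exp (D / C₁ * T.card) * Real.exp (B * T.card) := by
        rw [hδ]
        exact mul_le_mul_of_nonneg_left (hcen β hβ L n q x R hq hR hRa hRL hsep T) (Real.exp_nonneg _)
    _ = Real.exp ((B + D / C₁) * T.card) := by rw [← Real.exp_add]; ring_nf

end Recentring

end Summit.QuantumFields.YangMills.Cruxes.UVSeamRec.ResponsePinning

end
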